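import Literature.NumberTheory.ConnesConsani2021.ProlateContinuation
import HarnessLib

/-!
# The virial identity for the prolate eigenvalues `λ(n)` at bandwidth `c = 2π` and the
# non-degeneracy `|λ(n)| ≠ |λ(m)|` (`n ≠ m`)

RH-FREE classical analysis (label, line 1): Sturm–Liouville / finite-Fourier-transform identities for
Slepian's even prolate spheroidal wave functions `ψ_n = prolateFun n` (`c = 2π`); nothing in this file
mentions `ζ`, the critical strip or RH, and nothing here bears on the truth of RH.  bears_on (cell
rh-crit, corpus C1): §4 bookkeeping of Connes–Consani 2021 — input of the discharge of the named fact
`CC2021_sec4_lambda_basic` (clause 3, "`|λ(n)|` strictly decreasing", seat t10's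
`ProlateEigenvalueOrdering.lean`), whose consumers are the `hlam` binders of
`ArchimedeanTraceFormulaProofs`.

Sources.  A. Connes, C. Consani, *Weil positivity and trace formula, the archimedean place*, Selecta
Math. (N.S.) 27 (2021) 77 = arXiv:2006.13771 [bib `ConnesConsani2021`], §4 p. 16: (prolateeq) the even
prolate functions `ψ_n` are eigenfunctions of `𝐖 = −∂(1−x²)∂ + (2πx)²` (eigenvalue `χ_n`) AND of the
finite cosine transform, (cosalphan) `∫_{−1}^{1} ψ_n(x)cos(2πxy)dx = λ(n)ψ_n(y)` (`|y| ≤ 1`); "the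
`λ(n)` … decay very fast to `0`" with the signs `(−1)ⁿ` and `|λ(n)|` decreasing (the named fact
`CC2021_sec4_lambda_basic`, from Slepian–Pollak 1961 §III).  J. A. Hogan, J. D. Lakey, *Duration and
bandwidth limiting* (Birkhäuser 2012) [bib `HoganLakey2012`], Thm. 2.6.1–2.6.2 and Cor. 2.6.9 (after
Xiao–Rokhlin–Yarvin 2001): the end-point identities `ψ′(1) = (χ − c²)ψ(1)/2` and the eigenvalue
identities obtained by differentiating (cosalphan).

## What is proved (theorems only; no definition, no named fact)

With `A_n := prolateFunAn n` (the `C²` continuation of `ψ_n` to `ℝ`, `= ψ_n` on `[−1,1]`,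
`ProlateContinuation.lean`), `λ = prolateEigen`, and the Sturm–Liouville eigenvalues `χ_n`, `χ_m` taken
as HYPOTHESES in the shape produced by `(isProlateFunction_prolateFun n).eigen` (the tree has no
`prolateChi`):

* `deriv_prolateFunAn_one` — the END-POINT RELATION `A_n′(1) = (χ_n − 4π²)ψ_n(1)/2` (the prolate
  equation, valid on all of `ℝ` for `A_n`, read at the singular point `y = 1`);
* `prolateEigen_mul_deriv_deriv_prolateFunAn` — (cosalphan) differentiated twice:
  `λ(n)A_n″(y) = −∫_{−1}^{1}(2πx)²ψ_n(x)cos(2πxy)dx`;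
* `prolateEigen_mul_integral_mul_deriv_deriv` — pairing with `ψ_m` and Fubini on `[−1,1]²`:
  `λ(n)∫_{−1}^{1}ψ_mA_n″ = −(2π)²λ(m)∫_{−1}^{1}x²ψ_nψ_m`;
* `integral_mul_deriv_deriv_sub` — Green's identity on `[−1,1]` with the end-point relation:
  `∫ψ_mA_n″ − ∫ψ_nA_m″ = (χ_n − χ_m)ψ_n(1)ψ_m(1)`;
* **`prolateEigen_sq_sub_sq_mul_integral_sq_mul`** — THE VIRIAL IDENTITY
  `(λ(n)² − λ(m)²)·∫_{−1}^{1}x²ψ_n(x)ψ_m(x)dx = λ(n)λ(m)(χ_n − χ_m)ψ_n(1)ψ_m(1)/(2π)²` (all `n, m`);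
* `prolateFun_one_ne_zero` (`ψ_n(1) ≠ 0`), `eigen_ne_of_ne` (`χ_n ≠ χ_m` for `n ≠ m`), and the
  NON-DEGENERACY **`abs_prolateEigen_ne_of_ne`**: `|λ(n)| ≠ |λ(m)|` for `n ≠ m`.

WHAT THIS FILE IS NOT: no sign or monotonicity of `λ(n)` (seat t10's files), no numerical value,
nothing about `ζ` or RH.
-/

noncomputable section

open Real Set MeasureTheory intervalIntegral

namespace Literature.NumberTheory.ConnesConsani2021

open Literature.NumberTheory.LFunctions

/-! ## §1 Calculus of the continuation `A_n = prolateFunAn n` -/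

/-- `A_n` is differentiable with derivative `A_n′`. [cite: ConnesConsani2021, §5 p. 32, text before eq. (99)] -/
theorem hasDerivAt_prolateFunAn (n : ℕ) (y : ℝ) :
    HasDerivAt (prolateFunAn n) (deriv (prolateFunAn n) y) y :=
  (((contDiff_prolateFunAn n).differentiable (by norm_num)).differentiableAt).hasDerivAt

/-- `A_n′` is `C¹`. [cite: ConnesConsani2021, §5 p. 32, text before eq. (99)] -/
theorem contDiff_one_deriv_prolateFunAn (n : ℕ) : ContDiff ℝ 1 (deriv (prolateFunAn n)) := by
  have h := contDiff_prolateFunAn n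
  rw [show (2 : WithTop ℕ∞) = 1 + 1 from rfl] at h
  exact (contDiff_succ_iff_deriv.1 h).2.2

/-- `A_n′` is differentiable with derivative `A_n″`. [cite: ConnesConsani2021, §5 p. 32, text before eq. (99)] -/
theorem hasDerivAt_deriv_prolateFunAn (n : ℕ) (y : ℝ) :
    HasDerivAt (deriv (prolateFunAn n)) (deriv (deriv (prolateFunAn n)) y) y :=
  (((contDiff_one_deriv_prolateFunAn n).differentiable one_ne_zero).differentiableAt).hasDerivAt

/-- `A_n` is continuous. [cite: ConnesConsani2021, §5 p. 32, text before eq. (99)] -/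
theorem continuous_prolateFunAn (n : ℕ) : Continuous (prolateFunAn n) :=
  (contDiff_prolateFunAn n).continuous

/-- `A_n′` is continuous. [cite: ConnesConsani2021, §5 p. 32, text before eq. (99)] -/
theorem continuous_deriv_prolateFunAn (n : ℕ) : Continuous (deriv (prolateFunAn n)) :=
  (contDiff_one_deriv_prolateFunAn n).continuous

/-- `A_n″` is continuous. [cite: ConnesConsani2021, §5 p. 32, text before eq. (99)] -/
theorem continuous_deriv_deriv_prolateFunAn (n : ℕ) : Continuous (deriv (deriv (prolateFunAn n))) := by
  have h := contDiff_one_deriv_prolateFunAn n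
  rw [show (1 : WithTop ℕ∞) = 0 + 1 from rfl] at h
  exact (contDiff_succ_iff_deriv.1 h).2.2.continuous

/-- `A_n′` is odd: `A_n′(−y) = −A_n′(y)` (`A_n` is even). [cite: ConnesConsani2021, §4 p. 16 ("these are even functions", arXiv p0016:L18)] -/
theorem deriv_prolateFunAn_neg (n : ℕ) (y : ℝ) :
    deriv (prolateFunAn n) (-y) = -deriv (prolateFunAn n) y := by
  have h : (fun t => prolateFunAn n (-t)) = prolateFunAn n := funext (prolateFunAn_neg n)
  have h2 : deriv (fun t => prolateFunAn n (-t)) y = -deriv (prolateFunAn n) (-y) :=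
    deriv_comp_neg (prolateFunAn n) y
  rw [h] at h2
  linarith

/-- **The end-point relation** at the regular-singular point `y = 1` of the prolate equation:
`A_n′(1) = (χ_n − (2π)²)ψ_n(1)/2` — the equation `(1−y²)A″ = 2yA′ + ((2πy)² − χ)A` (valid on `ℝ` for the
continuation, `prolateFunAn_ode`) read at `y = 1`, where its leading coefficient vanishes.
[cite: HoganLakey2012, Cor. 2.6.9; ConnesConsani2021, §4 p. 16 eq. (prolateeq) (arXiv p0016:L17–L21)] -/
theorem deriv_prolateFunAn_one {n : ℕ} {χ : ℝ}
    (hχ : ∀ x ∈ Ioo (-1 : ℝ) 1,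
      -(deriv (fun y ↦ (1 ^ 2 - y ^ 2) * deriv (prolateFun n) y) x)
        + (2 * π * 1 * x) ^ 2 * prolateFun n x = χ * prolateFun n x) :
    deriv (prolateFunAn n) 1 = (χ - (2 * π) ^ 2) / 2 * prolateFun n 1 := by
  have h := prolateFunAn_ode hχ 1
  rw [prolateFunAn_one] at h
  simp only [one_pow, sub_self, zero_mul, mul_one] at h
  linarith

/-! ## §2 (cosalphan) differentiated twice -/

/-- `ψ_n` is interval-integrable on `[−1,1]`. [cite: ConnesConsani2021, §4 p. 16 (arXiv p0016:L17–L28)] -/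
theorem intervalIntegrable_prolateFun (n : ℕ) : IntervalIntegrable (prolateFun n) volume (-1) 1 := by
  apply ContinuousOn.intervalIntegrable
  rw [uIcc_of_le (by norm_num)]
  simpa using (isProlateFunction_prolateFun n).contDiffOn.continuousOn

/-- **(cosalphan) differentiated twice in `y`**: `λ(n)·A_n″(y) = −∫_{−1}^{1}(2πx)²ψ_n(x)cos(2πxy)dx`
for every real `y` (differentiation under the integral sign, `deriv_deriv_cosTransform`; written with the
continuation `A_n = ψ_n` inside the integral).
[cite: HoganLakey2012, Thm. 2.6.1–2.6.2; ConnesConsani2021, §4 p. 16 eq. (cosalphan) (arXiv p0016:L25–L28)] -/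
theorem prolateEigen_mul_deriv_deriv_prolateFunAn (n : ℕ) (y : ℝ) :
    prolateEigen n * deriv (deriv (prolateFunAn n)) y
      = ∫ x in (-1 : ℝ)..1, prolateFunAn n x * (-(2 * π * x) ^ 2 * Real.cos (2 * π * x * y)) := by
  rw [deriv_deriv_prolateFunAn, ← mul_assoc, mul_inv_cancel₀ (prolateEigen_ne_zero n), one_mul,
    deriv_deriv_cosTransform (intervalIntegrable_prolateFun n)]
  refine intervalIntegral.integral_congr fun x hx => ?_
  rw [uIcc_of_le (by norm_num)] at hx
  simp only [prolateFunAn_eq_prolateFun hx]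

/-! ## §3 Pairing with `ψ_m` and Fubini on `[−1,1]²` -/

/-- Fubini for the continuous integrand `A_m(y)·A_n(x)(2πx)²cos(2πxy)` on the square `[−1,1]²`.
[cite: HoganLakey2012, Thm. 2.6.1–2.6.2 (proof); ConnesConsani2021, §4 p. 16 eq. (cosalphan)] -/
theorem integral_integral_swap_prolateFunAn (n m : ℕ) :
    ∫ y in (-1 : ℝ)..1, ∫ x in (-1 : ℝ)..1,
        prolateFunAn m y * (prolateFunAn n x * (-(2 * π * x) ^ 2 * Real.cos (2 * π * x * y)))
      = ∫ x in (-1 : ℝ)..1, ∫ y in (-1 : ℝ)..1,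
        prolateFunAn m y * (prolateFunAn n x * (-(2 * π * x) ^ 2 * Real.cos (2 * π * x * y))) := by
  simp only [intervalIntegral.integral_of_le (show (-1 : ℝ) ≤ 1 by norm_num)]
  have hm : Integrable (prolateFunAn m) (volume.restrict (Ioc (-1 : ℝ) 1)) :=
    ((continuous_prolateFunAn m).integrableOn_Icc (a := -1) (b := 1)).mono_set Ioc_subset_Icc_self
  have hn : Integrable (fun x => prolateFunAn n x * (-(2 * π * x) ^ 2))
      (volume.restrict (Ioc (-1 : ℝ) 1)) :=
    (((continuous_prolateFunAn n).mul (by fun_prop)).integrableOn_Icc (a := -1) (b := 1)).mono_set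
      Ioc_subset_Icc_self
  have hint : Integrable (Function.uncurry fun (y x : ℝ) =>
      prolateFunAn m y * (prolateFunAn n x * (-(2 * π * x) ^ 2 * Real.cos (2 * π * x * y))))
      ((volume.restrict (Ioc (-1 : ℝ) 1)).prod (volume.restrict (Ioc (-1 : ℝ) 1))) := by
    change Integrable (fun z : ℝ × ℝ =>
      prolateFunAn m z.1 * (prolateFunAn n z.2 * (-(2 * π * z.2) ^ 2 * Real.cos (2 * π * z.2 * z.1)))) _
    have h2 : Integrable (fun z : ℝ × ℝ => prolateFunAn m z.1 * (prolateFunAn n z.2 * (-(2 * π * z.2) ^ 2)))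
        ((volume.restrict (Ioc (-1 : ℝ) 1)).prod (volume.restrict (Ioc (-1 : ℝ) 1))) :=
      hm.mul_prod hn
    refine (h2.bdd_mul (c := 1) (f := fun z : ℝ × ℝ => Real.cos (2 * π * z.2 * z.1))
      (Continuous.aestronglyMeasurable (by fun_prop)) ?_).congr ?_
    · exact Filter.Eventually.of_forall fun z => by
        rw [Real.norm_eq_abs]; exact Real.abs_cos_le_one _
    · exact Filter.Eventually.of_forall fun z => by ring
  exact integral_integral_swap hint

/-- **The pairing identity**: `λ(n)·∫_{−1}^{1}ψ_m(y)A_n″(y)dy = −(2π)²λ(m)·∫_{−1}^{1}x²ψ_n(x)ψ_m(x)dx`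
((cosalphan) differentiated twice, paired with `ψ_m`, Fubini, and (cosalphan) for `ψ_m`; written with
`A_m = ψ_m` on `[−1,1]` in the left integral).
[cite: HoganLakey2012, Thm. 2.6.1–2.6.2; ConnesConsani2021, §4 p. 16 eq. (cosalphan) (arXiv p0016:L25–L28)] -/
theorem prolateEigen_mul_integral_mul_deriv_deriv (n m : ℕ) :
    prolateEigen n * ∫ y in (-1 : ℝ)..1, prolateFunAn m y * deriv (deriv (prolateFunAn n)) y
      = -(2 * π) ^ 2 * prolateEigen m *
          ∫ x in (-1 : ℝ)..1, x ^ 2 * (prolateFun n x * prolateFun m x) := by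
  -- insert (cosalphan)″ under the `y`-integral
  have e1 : prolateEigen n * ∫ y in (-1 : ℝ)..1, prolateFunAn m y * deriv (deriv (prolateFunAn n)) y
      = ∫ y in (-1 : ℝ)..1, ∫ x in (-1 : ℝ)..1,
          prolateFunAn m y * (prolateFunAn n x * (-(2 * π * x) ^ 2 * Real.cos (2 * π * x * y))) := by
    rw [← intervalIntegral.integral_const_mul]
    refine intervalIntegral.integral_congr fun y _ => ?_
    rw [mul_left_comm, prolateEigen_mul_deriv_deriv_prolateFunAn n y, ← intervalIntegral.integral_const_mul]
  rw [e1, integral_integral_swap_prolateFunAn n m]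
  -- evaluate the inner `y`-integral by (cosalphan) for `ψ_m`
  have e2 : ∀ x ∈ uIcc (-1 : ℝ) 1,
      (∫ y in (-1 : ℝ)..1,
          prolateFunAn m y * (prolateFunAn n x * (-(2 * π * x) ^ 2 * Real.cos (2 * π * x * y))))
        = -(2 * π) ^ 2 * prolateEigen m * (x ^ 2 * (prolateFun n x * prolateFun m x)) := by
    intro x hx
    rw [uIcc_of_le (by norm_num)] at hx
    have h1 : (∫ y in (-1 : ℝ)..1,
        prolateFunAn m y * (prolateFunAn n x * (-(2 * π * x) ^ 2 * Real.cos (2 * π * x * y))))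
        = (prolateFunAn n x * (-(2 * π * x) ^ 2)) * cosTransform (prolateFun m) x := by
      rw [cosTransform, ← intervalIntegral.integral_const_mul]
      refine intervalIntegral.integral_congr fun y hy => ?_
      rw [uIcc_of_le (by norm_num)] at hy
      rw [prolateFunAn_eq_prolateFun hy, show 2 * π * y * x = 2 * π * x * y by ring]
      ring
    rw [h1, cosTransform_prolateFun_eq hx m, prolateFunAn_eq_prolateFun hx]
    ring
  rw [intervalIntegral.integral_congr e2, intervalIntegral.integral_const_mul]

/-! ## §4 Green's identity on `[−1,1]` with the end-point relation -/

/-- Integration by parts on `[−1,1]`: `∫A_mA_n″ = [A_mA_n′]_{−1}^{1} − ∫A_m′A_n′`.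
[cite: HoganLakey2012, Thm. 2.6.1–2.6.2 (proof); ConnesConsani2021, §4 p. 16 eq. (prolateeq)] -/
theorem integral_prolateFunAn_mul_deriv_deriv (n m : ℕ) :
    ∫ y in (-1 : ℝ)..1, prolateFunAn m y * deriv (deriv (prolateFunAn n)) y
      = prolateFunAn m 1 * deriv (prolateFunAn n) 1
          - prolateFunAn m (-1) * deriv (prolateFunAn n) (-1)
          - ∫ y in (-1 : ℝ)..1, deriv (prolateFunAn m) y * deriv (prolateFunAn n) y :=
  intervalIntegral.integral_mul_deriv_eq_deriv_mul
    (fun y _ => hasDerivAt_prolateFunAn m y) (fun y _ => hasDerivAt_deriv_prolateFunAn n y)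
    ((continuous_deriv_prolateFunAn m).intervalIntegrable _ _)
    ((continuous_deriv_deriv_prolateFunAn n).intervalIntegrable _ _)

/-- **Green's identity with the end-point relation**:
`∫_{−1}^{1}ψ_mA_n″ − ∫_{−1}^{1}ψ_nA_m″ = (χ_n − χ_m)ψ_n(1)ψ_m(1)` — the by-parts boundary
`[ψ_mA_n′ − ψ_nA_m′]_{−1}^{1} = 2(ψ_m(1)A_n′(1) − ψ_n(1)A_m′(1))` (evenness) evaluated with
`A′(1) = (χ − 4π²)ψ(1)/2`.
[cite: HoganLakey2012, Thm. 2.6.1–2.6.2, Cor. 2.6.9; ConnesConsani2021, §4 p. 16 eq. (prolateeq) (arXiv p0016:L17–L21)] -/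
theorem integral_mul_deriv_deriv_sub {n m : ℕ} {χn χm : ℝ}
    (hn : ∀ x ∈ Ioo (-1 : ℝ) 1,
      -(deriv (fun y ↦ (1 ^ 2 - y ^ 2) * deriv (prolateFun n) y) x)
        + (2 * π * 1 * x) ^ 2 * prolateFun n x = χn * prolateFun n x)
    (hm : ∀ x ∈ Ioo (-1 : ℝ) 1,
      -(deriv (fun y ↦ (1 ^ 2 - y ^ 2) * deriv (prolateFun m) y) x)
        + (2 * π * 1 * x) ^ 2 * prolateFun m x = χm * prolateFun m x) :
    (∫ y in (-1 : ℝ)..1, prolateFunAn m y * deriv (deriv (prolateFunAn n)) y)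
      - (∫ y in (-1 : ℝ)..1, prolateFunAn n y * deriv (deriv (prolateFunAn m)) y)
      = (χn - χm) * (prolateFun n 1 * prolateFun m 1) := by
  rw [integral_prolateFunAn_mul_deriv_deriv n m, integral_prolateFunAn_mul_deriv_deriv m n,
    prolateFunAn_neg, prolateFunAn_neg, deriv_prolateFunAn_neg, deriv_prolateFunAn_neg,
    deriv_prolateFunAn_one hn, deriv_prolateFunAn_one hm, prolateFunAn_one, prolateFunAn_one]
  have hsym : ∫ y in (-1 : ℝ)..1, deriv (prolateFunAn n) y * deriv (prolateFunAn m) y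
      = ∫ y in (-1 : ℝ)..1, deriv (prolateFunAn m) y * deriv (prolateFunAn n) y :=
    intervalIntegral.integral_congr fun y _ => mul_comm _ _
  rw [hsym]
  ring

/-! ## §5 The virial identity -/

/-- RH-FREE. **THE VIRIAL IDENTITY for the prolate eigenvalues at `c = 2π`**: for all `n, m`,
`(λ(n)² − λ(m)²)·∫_{−1}^{1}x²ψ_n(x)ψ_m(x)dx = λ(n)λ(m)(χ_n − χ_m)ψ_n(1)ψ_m(1)/(2π)²`, where `χ_n, χ_m`
are the Sturm–Liouville eigenvalues of `ψ_n, ψ_m` (hypotheses in the shape of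
`(isProlateFunction_prolateFun n).eigen`).  Proof: the pairing identity for `(n,m)` and `(m,n)`
(`λ(n)∫ψ_mA_n″ = −(2π)²λ(m)T`, `λ(m)∫ψ_nA_m″ = −(2π)²λ(n)T`, `T = ∫x²ψ_nψ_m`) combined with Green's
identity `∫ψ_mA_n″ − ∫ψ_nA_m″ = (χ_n − χ_m)ψ_n(1)ψ_m(1)`.
[cite: HoganLakey2012, Thm. 2.6.1–2.6.2, Cor. 2.6.9; ConnesConsani2021, §4 p. 16 eq. (prolateeq)–(cosalphan) (arXiv p0016:L17–L28); SlepianPollak1961, §III] -/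
theorem prolateEigen_sq_sub_sq_mul_integral_sq_mul (n m : ℕ) {χn χm : ℝ}
    (hn : ∀ x ∈ Ioo (-1 : ℝ) 1,
      -(deriv (fun y ↦ (1 ^ 2 - y ^ 2) * deriv (prolateFun n) y) x)
        + (2 * π * 1 * x) ^ 2 * prolateFun n x = χn * prolateFun n x)
    (hm : ∀ x ∈ Ioo (-1 : ℝ) 1,
      -(deriv (fun y ↦ (1 ^ 2 - y ^ 2) * deriv (prolateFun m) y) x)
        + (2 * π * 1 * x) ^ 2 * prolateFun m x = χm * prolateFun m x) :
    (prolateEigen n ^ 2 - prolateEigen m ^ 2) *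
        (∫ x in (-1 : ℝ)..1, x ^ 2 * (prolateFun n x * prolateFun m x))
      = prolateEigen n * prolateEigen m * (χn - χm) * (prolateFun n 1 * prolateFun m 1)
          / (2 * π) ^ 2 := by
  have e1 := prolateEigen_mul_integral_mul_deriv_deriv n m
  have e2 := prolateEigen_mul_integral_mul_deriv_deriv m n
  have hT : ∫ x in (-1 : ℝ)..1, x ^ 2 * (prolateFun m x * prolateFun n x)
      = ∫ x in (-1 : ℝ)..1, x ^ 2 * (prolateFun n x * prolateFun m x) :=
    intervalIntegral.integral_congr fun x _ => by simp only [mul_comm (prolateFun m x)]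
  rw [hT] at e2
  have e3 := integral_mul_deriv_deriv_sub hn hm
  have hπ : (2 * π) ^ 2 ≠ 0 := by positivity
  rw [eq_div_iff hπ]
  linear_combination (-prolateEigen m) * e1 + prolateEigen n * e2
    + (prolateEigen n * prolateEigen m) * e3

/-! ## §6 Non-degeneracy `|λ(n)| ≠ |λ(m)|` -/

/-- `ψ_n(1) ≠ 0` (indeed `ψ_n(1)² = 1/(2∫₀¹u_b²)` at the critical Frobenius parameter `b` of `ψ_n`,
`prolateFun_one_sq_eq_of_frobSol`; Hogan–Lakey Lemma 2.6.8 "`φ_n(1) ≠ 0`").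
[cite: HoganLakey2012, Lemma 2.6.8; ConnesConsani2021, §4 p. 16 (arXiv p0016:L17–L28)] -/
theorem prolateFun_one_ne_zero (n : ℕ) : prolateFun n 1 ≠ 0 := by
  obtain ⟨b, hB, hk⟩ := exists_frobSol₁_zero_eq one_pos n
  rw [frobZeros_def] at hk
  have h := prolateFun_one_sq_eq_of_frobSol hB hk
  have hI := integral_frobSol_sq_pos one_pos b
  intro h0
  rw [h0] at h
  have : (0 : ℝ) < 1 / (2 * ∫ x in (0 : ℝ)..1, frobSol 1 b x ^ 2) := by positivity
  rw [← h] at this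
  norm_num at this

/-- Distinct even prolate functions have distinct Sturm–Liouville eigenvalues: `χ_n ≠ χ_m` for
`n ≠ m` (two prolate functions with the same eigenvalue are proportional, `eq_mul_of_eigen_eq`, hence
have the same zeros, hence the same zero count `2n = 2m`).
[cite: Hartman2002, Ch. XI §4 Thm 4.1; SlepianPollak1961, §III; ConnesConsani2021, §4 p. 16 (arXiv p0016:L17–L21)] -/
theorem eigen_ne_of_ne {n m : ℕ} (h : n ≠ m) {χn χm : ℝ}
    (hn : ∀ x ∈ Ioo (-1 : ℝ) 1,
      -(deriv (fun y ↦ (1 ^ 2 - y ^ 2) * deriv (prolateFun n) y) x)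
        + (2 * π * 1 * x) ^ 2 * prolateFun n x = χn * prolateFun n x)
    (hm : ∀ x ∈ Ioo (-1 : ℝ) 1,
      -(deriv (fun y ↦ (1 ^ 2 - y ^ 2) * deriv (prolateFun m) y) x)
        + (2 * π * 1 * x) ^ 2 * prolateFun m x = χm * prolateFun m x) :
    χn ≠ χm := by
  intro hχ
  have hf := isProlateFunction_prolateFun n
  have hg := isProlateFunction_prolateFun m
  rw [hχ] at hn
  have hprop := hf.eq_mul_of_eigen_eq hg hn hm
  have hc : prolateFun n 0 / prolateFun m 0 ≠ 0 :=
    div_ne_zero (prolateFun_zero_pos n).ne' (prolateFun_zero_pos m).ne'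
  have hZ : {x : ℝ | x ∈ Ioo (-1 : ℝ) 1 ∧ prolateFun n x = 0}
      = {x : ℝ | x ∈ Ioo (-1 : ℝ) 1 ∧ prolateFun m x = 0} := by
    ext x
    simp only [mem_setOf_eq, hprop x, mul_eq_zero, hc, false_or]
  have h2 : 2 * n = 2 * m := by
    rw [← hf.zeros_card, ← hg.zeros_card, hZ]
  omega

/-- RH-FREE. **NON-DEGENERACY of the prolate eigenvalues at `c = 2π`**: `|λ(n)| ≠ |λ(m)|` for `n ≠ m`
— from the virial identity: `|λ(n)| = |λ(m)|` kills its left side, while the right side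
`λ(n)λ(m)(χ_n − χ_m)ψ_n(1)ψ_m(1)/(2π)²` has every factor non-zero (`prolateEigen_ne_zero`,
`eigen_ne_of_ne`, `prolateFun_one_ne_zero`).  (Slepian–Pollak take the simplicity of the `|λ|`-spectrum
from the continuation in the bandwidth parameter; here it is a fixed-`c` identity.)
[cite: SlepianPollak1961, §III; HoganLakey2012, Thm. 2.6.1–2.6.2, Cor. 2.6.9; ConnesConsani2021, §4 p. 16 (arXiv p0016:L22–L25)] -/
theorem abs_prolateEigen_ne_of_ne {n m : ℕ} (h : n ≠ m) : |prolateEigen n| ≠ |prolateEigen m| := by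
  obtain ⟨χn, hn⟩ := (isProlateFunction_prolateFun n).eigen
  obtain ⟨χm, hm⟩ := (isProlateFunction_prolateFun m).eigen
  intro habs
  have hsq : prolateEigen n ^ 2 - prolateEigen m ^ 2 = 0 := by
    rw [← sq_abs (prolateEigen n), ← sq_abs (prolateEigen m), habs, sub_self]
  have hD := prolateEigen_sq_sub_sq_mul_integral_sq_mul n m hn hm
  rw [hsq, zero_mul] at hD
  have hπ : (2 * π) ^ 2 ≠ 0 := by positivity
  have hne : prolateEigen n * prolateEigen m * (χn - χm) * (prolateFun n 1 * prolateFun m 1)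
      / (2 * π) ^ 2 ≠ 0 := by
    refine div_ne_zero ?_ hπ
    exact mul_ne_zero (mul_ne_zero (mul_ne_zero (prolateEigen_ne_zero n) (prolateEigen_ne_zero m))
      (sub_ne_zero.2 (eigen_ne_of_ne h hn hm)))
      (mul_ne_zero (prolateFun_one_ne_zero n) (prolateFun_one_ne_zero m))
  exact hne hD.symm

/-- RH-FREE. Equivalently: `λ(n)² ≠ λ(m)²` for `n ≠ m`. [cite: SlepianPollak1961, §III; ConnesConsani2021, §4 p. 16 (arXiv p0016:L22–L25)] -/
theorem prolateEigen_sq_ne_of_ne {n m : ℕ} (h : n ≠ m) : prolateEigen n ^ 2 ≠ prolateEigen m ^ 2 := by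
  intro h2
  apply abs_prolateEigen_ne_of_ne h
  rw [← sq_abs (prolateEigen n), ← sq_abs (prolateEigen m)] at h2
  exact (pow_left_inj₀ (abs_nonneg _) (abs_nonneg _) two_ne_zero).1 h2

end Literature.NumberTheory.ConnesConsani2021
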